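import Summits.QuantumFields.YangMills.Theorems.BalabanUVNodesPortS1JacobianHoloDomain

/-!
# NODE O port PT-A — ROWS (a)(b) OF `stub_LZjac` ON THE LOOP-SMALL `SL(2,ℂ)` DOMAIN: `det A₁^ℂ(c)(W)` IS WITHIN `r³∕2` OF ITS FLAT VALUE `r³ = (N_c∕|I|)³` for every `SL(2,ℂ)`-valued
# bond-matrix field whose (0.4) loop matrices lie in the `1∕3`-polydisc at every coarse bond and within `α` of `1` at the non-central indices of `c` (`646·α ≤ r∕8`); hence `det ∈`
# slit plane, the average is invertible, the holomorphic Jacobian factor `jacFactorC c = log det A₁^ℂ(c)` is ℂ-ANALYTIC there (✓p812449's three hypotheses DISCHARGED) and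
# `|jacFactorC c W − log r³| ≤ 1`

Cell `ym-nodeO-ideate`, porter seat `ymgap-nodeO-port-PTZ-1` (gen 6) as STUB-WORKER under the `stub_LZjac` line of 27930's skeleton `pta_residueW` (director-ym №522 (2): item (3) of
▶ PTA-1 g5's gen-6 list, PORT-PLAN-v5 §4 rows (a)(b) «`det A₁^ℂ(c)` near `(N_c∕|I|)³` on the whole complex domain»); `--supports stmt-QuantumFields-27930` (helper), NO `--workitem`.
[I] = [Balaban1987RG1], [B7] = [Balaban1985Averaging], [15] = [Balaban1985Variational].  FILE (C) of three (file (A) `…JacobianHoloPrivate`: private-coordinate bookkeeping; file (B)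
`…JacobianHoloDomain`: the response normal form and its (0.8) estimate).
CONSUMED BY NAME, nothing modified: files (A)(B); ✓p812392 `jacBlockC`∕`jacFactorC`∕`su2CoordC`; ✓p812449 `analyticAt_jacFactorC`, `adjugate_eq_trace_smul_one_sub`; ✓p812756 `det_avgMh_eq_one`,
`sum_su2CoordC_smul_su2Gen`, `su2CoordC_add ∕ _smul ∕ _sum_smul`; ✓p812578 `det_adMatC_of_det_eq_one` (`det Ad^ℂ(g) = (det g)³`), `self_mul_adjugate_of_det_eq_one`, `adjugate_mul_self_of_det_eq_one`;
`ExpMeanLog.det_eml_eq_one`; `BlockAveragingPlaquetteBound.norm_eml_sub_one_le_six_mul`; ✓ `star_su2Gen`, `trace_su2Gen`, `norm_trace_le_two_mul`; `BlockAveragingHaarAC.nCentral_pos`; Mathlib's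
`Matrix.l2_opNorm_mulVec`, `CStarRing.norm_of_mem_unitary`, `Matrix.det_fin_three`, `Matrix.adjugate_fin_two`, `Complex.log_ofReal_mul`, `Complex.norm_log_one_add_half_le_self`.
ROAD.  `A₁^ℂ(c)(W)_{ia} = su2CoordC(R_a·(avgMh W c)⁻¹)_i` with `R_a` the response in the direction `su2Gen a·W(β)`; `(avgMh W c)⁻¹ = adj(axial)·adj(eml)` (determinant one); by file (B)'s normal
form `R_a·adj(axial) = D eml[i ↦ cen ? 0 : −loop_i·X̃_a] + eml·X̃_a` with `X̃_a = pre·su2Gen a·adj pre = Σ_b Ad^ℂ(pre)_{ba}·su2Gen b` (traceless), so by ℂ-linearity `A₁^ℂ(c)(W) = N·Ad^ℂ(pre)`,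
`N_{ib} = su2CoordC((D eml[…su2Gen b…] + eml·su2Gen b)·adj eml)_i`, `det Ad^ℂ(pre) = (det pre)³ = 1`; file (B)'s estimate (`314α` per unit direction, `‖su2Gen b‖ = 1`) and `‖adj eml − 1‖ ≤ 18α`
put `N` within `646α` of `r·1` entrywise; a `3 × 3` determinant within `e ≤ r∕8` of `r·1` entrywise has `|det − r³| ≤ 3r²e + 6re² + 6e³ ≤ r³∕2`.
* §5 matrix bookkeeping: `norm_entry_le_norm` (`|Y_{ab}| ≤ ‖Y‖`, L2-operator norm; adapted from `B12Eq311Models.norm_slProj_le`), `norm_adjugate_sub_one_le` (`‖adj E − 1‖ ≤ 3‖E − 1‖` on `M₂(ℂ)`),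
  `norm_su2CoordC_le`, `su2Gen_mul_self`, `norm_su2Gen` (`= 1`, unitary), ★ `norm_det_sub_cube_le` (the `3 × 3` perturbation bound), `su2CoordC_su2Gen`, `su2CoordC_sub`, `responseDir_sum_smul`.
* §6 ★★★ `norm_det_jacBlockC_sub_le` (`‖det A₁^ℂ(c)(W) − r³‖ ≤ r³∕2`), ★★ `det_jacBlockC_mem_slitPlane`, `isUnit_avgMh_of_det_eq_one`, ★★★ `analyticAt_jacFactorC_of_loopSmall` (row (a)), ★★
  `norm_jacFactorC_sub_log_le` (row (b): `‖jacFactorC c W − log r³‖ ≤ 1`).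

HONEST FRAMING.  Kernel calculus ∕ linear algebra over the tree's own holomorphic model; NOTHING of Bałaban's estimates asserted, ported or discharged; rows (a)(b) here are at the level of ONE
averaging step, ONE coarse bond, one torus, in LOOP-SMALLNESS currency — the road from the (1.11)–(1.16) conditions of `recordUc X` to loop smallness of `axialize(Ū^k 𝐔)` (complex plaquette →
loop smallness, the `axialize ∘ Ū^k` composition, rows (c)(d) at the record, the packaging (e)) remains PTA-1 g6's ∕ later; the radii are the porter's (perturbative, `646α ≤ r∕8`, `r = L^{1−d}`-sized);
`stub_LZjac` OPEN; `stub_LZdet` BLOCKED-ON P0 (α)+(β); `stub_FE` XXL; 27930 OPEN · no claim; 26648 OPEN; K0⁷∕K-Ax OPEN; NODE O 0∕1; COUNT 8∕28 · K 1∕4 UNMOVED; finite `𝕋⁴_{L^K}` at fixed ε —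
NOT continuum ∕ OS ∕ Clay; **the Yang–Mills mass gap is NOT proved by any of this.**  No `sorry`, no `def`, no `instance`, no `notation`; standard axioms.
-/

noncomputable section

open scoped BigOperators Matrix.Norms.L2Operator Topology

namespace Summit.QuantumFields.YangMills.Theorems.BalabanUVNodesPortS1

open Summit.QuantumFields.YangMills.Theorems.K0RecordFormatNames
open Literature.MathematicalPhysics.QuantumFieldTheory.Balaban1983to89
open Literature.MathematicalPhysics.QuantumFieldTheory.Balaban1983to89.Node00
open Literature.MathematicalPhysics.QuantumFieldTheory.Balaban1983to89.T4Continuum (T4Family LStep walk walkEnd Letter)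
open Literature.MathematicalPhysics.QuantumFieldTheory.Balaban1983to89.BlockAveraging (Idx off)
open Literature.MathematicalPhysics.QuantumFieldTheory.Balaban1983to89.BlockAveragingHaarAC (centralBond IsCentral nCentral)
open Literature.MathematicalPhysics.QuantumFieldTheory.Balaban1983to89.ExpMeanLog (eml eml_eq_exp differentiableAt_eml)
open Literature.MathematicalPhysics.QuantumFieldTheory.Balaban1983to89.BlockAveragingPlaquetteBound (norm_eml_sub_one_le_six_mul)
open Literature.MathematicalPhysics.QuantumFieldTheory.Balaban1983to89.B15AveragingHolomorphic
open _root_.Matrix _root_.Filter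

variable {P : Params} {j : ℕ}

/-! ## §5  Matrix bookkeeping on `M₂(ℂ)` (L2-operator norm): entries, trace, the adjugate near `1`, the complex `su2Gen`-coordinates, `‖su2Gen a‖ = 1`, and a `3 × 3` determinant
perturbation bound -/

section MatrixLemmas

/-- Every entry is bounded by the operator norm: `|Y a b| ≤ ‖Y‖` (`Y a b = (Y e_b)_a`).  Adapted from `B12Eq311Models.norm_slProj_le`. [folklore] -/
theorem norm_entry_le_norm {N : ℕ} (Y : Matrix (Fin N) (Fin N) ℂ) (a b : Fin N) : ‖Y a b‖ ≤ ‖Y‖ := by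
  have h := Matrix.l2_opNorm_mulVec Y (EuclideanSpace.single b (1 : ℂ))
  rw [PiLp.norm_single, norm_one, mul_one] at h
  refine le_trans ?_ h
  have hs : (⇑(EuclideanSpace.single b (1 : ℂ)) : Fin N → ℂ) = Pi.single b 1 :=
    funext fun k => by simp [Pi.single_apply, eq_comm]
  have h2 := PiLp.norm_apply_le ((EuclideanSpace.equiv (Fin N) ℂ).symm (Y.mulVec ⇑(EuclideanSpace.single b (1 : ℂ)))) a
  have h3 : ((EuclideanSpace.equiv (Fin N) ℂ).symm (Y.mulVec ⇑(EuclideanSpace.single b (1 : ℂ)))) a = Y a b := by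
    rw [hs, Matrix.mulVec_single_one]
    rfl
  rwa [h3] at h2

/-- **The adjugate of a `2 × 2` matrix near `1` is near `1`**: `‖adj E − 1‖ ≤ 3‖E − 1‖` (`adj E − 1 = tr(E − 1)·1 − (E − 1)`). [folklore] -/
theorem norm_adjugate_sub_one_le (E : MatA 2) : ‖E.adjugate - 1‖ ≤ 3 * ‖E - 1‖ := by
  have h : E.adjugate - 1 = (E - 1).trace • (1 : MatA 2) - (E - 1) := by
    ext i k
    rw [Matrix.adjugate_fin_two]
    fin_cases i <;> fin_cases k <;> simp [Matrix.trace_fin_two] <;> ring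
  rw [h]
  calc ‖(E - 1).trace • (1 : MatA 2) - (E - 1)‖ ≤ ‖(E - 1).trace • (1 : MatA 2)‖ + ‖E - 1‖ := norm_sub_le _ _
    _ ≤ 2 * ‖E - 1‖ * 1 + ‖E - 1‖ := by
        refine add_le_add ?_ le_rfl
        rw [norm_smul, norm_one]
        exact mul_le_mul_of_nonneg_right (norm_trace_le_two_mul _) zero_le_one
    _ = 3 * ‖E - 1‖ := by ring

/-- The complex `su2Gen`-coordinates are bounded by the operator norm: `|su2CoordC Y i| ≤ ‖Y‖`. [folklore] -/
theorem norm_su2CoordC_le (Y : MatA 2) (i : Fin 3) : ‖su2CoordC Y i‖ ≤ ‖Y‖ := by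
  have h00 := norm_entry_le_norm Y 0 0
  have h01 := norm_entry_le_norm Y 0 1
  have h10 := norm_entry_le_norm Y 1 0
  fin_cases i
  · show ‖-Complex.I * (Y 0 1 + Y 1 0) / 2‖ ≤ ‖Y‖
    rw [norm_div, norm_mul, norm_neg, Complex.norm_I, one_mul]
    have : ‖Y 0 1 + Y 1 0‖ ≤ ‖Y‖ + ‖Y‖ := (norm_add_le _ _).trans (add_le_add h01 h10)
    have h2 : ‖(2 : ℂ)‖ = 2 := by simp
    rw [h2]; linarith
  · show ‖(Y 0 1 - Y 1 0) / 2‖ ≤ ‖Y‖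
    rw [norm_div]
    have : ‖Y 0 1 - Y 1 0‖ ≤ ‖Y‖ + ‖Y‖ := (norm_sub_le _ _).trans (add_le_add h01 h10)
    have h2 : ‖(2 : ℂ)‖ = 2 := by simp
    rw [h2]; linarith
  · show ‖-Complex.I * Y 0 0‖ ≤ ‖Y‖
    rw [norm_mul, norm_neg, Complex.norm_I, one_mul]
    exact h00

/-- `su2Gen a · su2Gen a = −1`. [folklore] -/
theorem su2Gen_mul_self (a : Fin 3) : su2Gen a * su2Gen a = -1 := by
  fin_cases a <;>
    · ext i k
      fin_cases i <;> fin_cases k <;> simp [su2Gen, Matrix.mul_apply, Fin.sum_univ_two]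

/-- The generators are unitary, hence `‖su2Gen a‖ = 1`. [folklore] -/
theorem norm_su2Gen (a : Fin 3) : ‖su2Gen a‖ = 1 := by
  have hu : su2Gen a ∈ unitary (MatA 2) := by
    rw [Unitary.mem_iff, star_su2Gen, neg_mul, mul_neg, su2Gen_mul_self, neg_neg]
    exact ⟨rfl, rfl⟩
  exact CStarRing.norm_of_mem_unitary hu

/-- **A `3 × 3` DETERMINANT NEAR A SCALAR**: if every entry of `A − r·1` is bounded by `e`, then `|det A − r³| ≤ 3r²e + 6re² + 6e³` (expansion of `det(r·1 + E)`). [folklore] -/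
theorem norm_det_sub_cube_le (A : Matrix (Fin 3) (Fin 3) ℂ) {r e : ℝ} (hr : 0 ≤ r) (he : 0 ≤ e)
    (hA : ∀ i b, ‖A i b - (if i = b then (r : ℂ) else 0)‖ ≤ e) : ‖A.det - (r : ℂ) ^ 3‖ ≤ 3 * r ^ 2 * e + 6 * r * e ^ 2 + 6 * e ^ 3 := by
  set E : Matrix (Fin 3) (Fin 3) ℂ := A - (r : ℂ) • (1 : Matrix (Fin 3) (Fin 3) ℂ) with hE
  have hEe : ∀ i b, ‖E i b‖ ≤ e := fun i b => by
    have h := hA i b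
    simp only [hE, Matrix.sub_apply, Matrix.smul_apply, Matrix.one_apply, smul_eq_mul, mul_ite, mul_one, mul_zero]
    exact h
  have hAE : A = (r : ℂ) • (1 : Matrix (Fin 3) (Fin 3) ℂ) + E := by rw [hE]; abel
  have hdet : A.det - (r : ℂ) ^ 3 =
      (r : ℂ) ^ 2 * (E 0 0 + E 1 1 + E 2 2) +
        (r : ℂ) * (E 0 0 * E 1 1 - E 0 1 * E 1 0 + E 0 0 * E 2 2 - E 0 2 * E 2 0 + E 1 1 * E 2 2 - E 1 2 * E 2 1) +
        (E 0 0 * E 1 1 * E 2 2 - E 0 0 * E 1 2 * E 2 1 - E 0 1 * E 1 0 * E 2 2 + E 0 1 * E 1 2 * E 2 0 + E 0 2 * E 1 0 * E 2 1 - E 0 2 * E 1 1 * E 2 0) := by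
    rw [hAE, Matrix.det_fin_three]
    simp only [Matrix.add_apply, Matrix.smul_apply, Matrix.one_apply, smul_eq_mul]
    simp
    ring
  rw [hdet]
  have h1 : ‖(r : ℂ) ^ 2 * (E 0 0 + E 1 1 + E 2 2)‖ ≤ 3 * r ^ 2 * e := by
    rw [norm_mul, norm_pow, Complex.norm_real, Real.norm_of_nonneg hr]
    have : ‖E 0 0 + E 1 1 + E 2 2‖ ≤ e + e + e :=
      (norm_add_le _ _).trans (add_le_add ((norm_add_le _ _).trans (add_le_add (hEe 0 0) (hEe 1 1))) (hEe 2 2))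
    nlinarith [sq_nonneg r]
  have hp2 : ∀ i b k l, ‖E i b * E k l‖ ≤ e ^ 2 := fun i b k l => by
    rw [norm_mul, sq]; exact mul_le_mul (hEe i b) (hEe k l) (norm_nonneg _) he
  have hp3 : ∀ i b k l m n, ‖E i b * E k l * E m n‖ ≤ e ^ 3 := fun i b k l m n => by
    rw [norm_mul, pow_succ]; exact mul_le_mul (hp2 i b k l) (hEe m n) (norm_nonneg _) (sq_nonneg _)
  have h2 : ‖(r : ℂ) * (E 0 0 * E 1 1 - E 0 1 * E 1 0 + E 0 0 * E 2 2 - E 0 2 * E 2 0 + E 1 1 * E 2 2 - E 1 2 * E 2 1)‖ ≤ 6 * r * e ^ 2 := by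
    rw [norm_mul, Complex.norm_real, Real.norm_of_nonneg hr]
    have : ‖E 0 0 * E 1 1 - E 0 1 * E 1 0 + E 0 0 * E 2 2 - E 0 2 * E 2 0 + E 1 1 * E 2 2 - E 1 2 * E 2 1‖ ≤ 6 * e ^ 2 := by
      have := hp2 0 0 1 1; have := hp2 0 1 1 0; have := hp2 0 0 2 2; have := hp2 0 2 2 0; have := hp2 1 1 2 2; have := hp2 1 2 2 1
      calc _ ≤ ‖E 0 0 * E 1 1 - E 0 1 * E 1 0 + E 0 0 * E 2 2 - E 0 2 * E 2 0 + E 1 1 * E 2 2‖ + ‖E 1 2 * E 2 1‖ := norm_sub_le _ _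
        _ ≤ ‖E 0 0 * E 1 1 - E 0 1 * E 1 0 + E 0 0 * E 2 2 - E 0 2 * E 2 0‖ + ‖E 1 1 * E 2 2‖ + ‖E 1 2 * E 2 1‖ := by gcongr; exact norm_add_le _ _
        _ ≤ ‖E 0 0 * E 1 1 - E 0 1 * E 1 0 + E 0 0 * E 2 2‖ + ‖E 0 2 * E 2 0‖ + ‖E 1 1 * E 2 2‖ + ‖E 1 2 * E 2 1‖ := by gcongr; exact norm_sub_le _ _
        _ ≤ ‖E 0 0 * E 1 1 - E 0 1 * E 1 0‖ + ‖E 0 0 * E 2 2‖ + ‖E 0 2 * E 2 0‖ + ‖E 1 1 * E 2 2‖ + ‖E 1 2 * E 2 1‖ := by gcongr; exact norm_add_le _ _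
        _ ≤ ‖E 0 0 * E 1 1‖ + ‖E 0 1 * E 1 0‖ + ‖E 0 0 * E 2 2‖ + ‖E 0 2 * E 2 0‖ + ‖E 1 1 * E 2 2‖ + ‖E 1 2 * E 2 1‖ := by gcongr; exact norm_sub_le _ _
        _ ≤ 6 * e ^ 2 := by linarith
    nlinarith
  have h3 : ‖E 0 0 * E 1 1 * E 2 2 - E 0 0 * E 1 2 * E 2 1 - E 0 1 * E 1 0 * E 2 2 + E 0 1 * E 1 2 * E 2 0 + E 0 2 * E 1 0 * E 2 1 - E 0 2 * E 1 1 * E 2 0‖ ≤ 6 * e ^ 3 := by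
    have := hp3 0 0 1 1 2 2; have := hp3 0 0 1 2 2 1; have := hp3 0 1 1 0 2 2; have := hp3 0 1 1 2 2 0; have := hp3 0 2 1 0 2 1; have := hp3 0 2 1 1 2 0
    calc _ ≤ ‖E 0 0 * E 1 1 * E 2 2 - E 0 0 * E 1 2 * E 2 1 - E 0 1 * E 1 0 * E 2 2 + E 0 1 * E 1 2 * E 2 0 + E 0 2 * E 1 0 * E 2 1‖ + ‖E 0 2 * E 1 1 * E 2 0‖ := norm_sub_le _ _
      _ ≤ ‖E 0 0 * E 1 1 * E 2 2 - E 0 0 * E 1 2 * E 2 1 - E 0 1 * E 1 0 * E 2 2 + E 0 1 * E 1 2 * E 2 0‖ + ‖E 0 2 * E 1 0 * E 2 1‖ + ‖E 0 2 * E 1 1 * E 2 0‖ := by gcongr; exact norm_add_le _ _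
      _ ≤ ‖E 0 0 * E 1 1 * E 2 2 - E 0 0 * E 1 2 * E 2 1 - E 0 1 * E 1 0 * E 2 2‖ + ‖E 0 1 * E 1 2 * E 2 0‖ + ‖E 0 2 * E 1 0 * E 2 1‖ + ‖E 0 2 * E 1 1 * E 2 0‖ := by gcongr; exact norm_add_le _ _
      _ ≤ ‖E 0 0 * E 1 1 * E 2 2 - E 0 0 * E 1 2 * E 2 1‖ + ‖E 0 1 * E 1 0 * E 2 2‖ + ‖E 0 1 * E 1 2 * E 2 0‖ + ‖E 0 2 * E 1 0 * E 2 1‖ + ‖E 0 2 * E 1 1 * E 2 0‖ := by gcongr; exact norm_sub_le _ _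
      _ ≤ ‖E 0 0 * E 1 1 * E 2 2‖ + ‖E 0 0 * E 1 2 * E 2 1‖ + ‖E 0 1 * E 1 0 * E 2 2‖ + ‖E 0 1 * E 1 2 * E 2 0‖ + ‖E 0 2 * E 1 0 * E 2 1‖ + ‖E 0 2 * E 1 1 * E 2 0‖ := by gcongr; exact norm_sub_le _ _
      _ ≤ 6 * e ^ 3 := by linarith
  calc _ ≤ ‖(r : ℂ) ^ 2 * (E 0 0 + E 1 1 + E 2 2) +
        (r : ℂ) * (E 0 0 * E 1 1 - E 0 1 * E 1 0 + E 0 0 * E 2 2 - E 0 2 * E 2 0 + E 1 1 * E 2 2 - E 1 2 * E 2 1)‖ +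
        ‖E 0 0 * E 1 1 * E 2 2 - E 0 0 * E 1 2 * E 2 1 - E 0 1 * E 1 0 * E 2 2 + E 0 1 * E 1 2 * E 2 0 + E 0 2 * E 1 0 * E 2 1 - E 0 2 * E 1 1 * E 2 0‖ := norm_add_le _ _
    _ ≤ 3 * r ^ 2 * e + 6 * r * e ^ 2 + 6 * e ^ 3 := by
        have h12 := norm_add_le ((r : ℂ) ^ 2 * (E 0 0 + E 1 1 + E 2 2))
          ((r : ℂ) * (E 0 0 * E 1 1 - E 0 1 * E 1 0 + E 0 0 * E 2 2 - E 0 2 * E 2 0 + E 1 1 * E 2 2 - E 1 2 * E 2 1))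
        linarith

end MatrixLemmas


/-! ## §6  ★★★ `det A₁^ℂ(c)(W)` is within `r³∕2` of `r³ = (N_c∕|I|)³` on the loop-small `SL(2,ℂ)` domain; slit plane, invertible average, analyticity of the Jacobian factor -/

/-- `su2CoordC (su2Gen b) i = δ_{ib}`. [folklore] -/
theorem su2CoordC_su2Gen (b i : Fin 3) : su2CoordC (su2Gen b) i = if i = b then 1 else 0 := by
  have h := su2CoordC_sum_smul_su2Gen (fun a => if a = b then (1 : ℂ) else 0) i
  simp only [ite_smul, one_smul, zero_smul, Finset.sum_ite_eq', Finset.mem_univ, if_true] at h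
  rw [h]

/-- `su2CoordC_i` respects subtraction. [folklore] -/
theorem su2CoordC_sub (M N : MatA 2) (i : Fin 3) : su2CoordC (M - N) i = su2CoordC M i - su2CoordC N i := by
  fin_cases i <;> simp [su2CoordC] <;> ring

/-- The direction family `i ↦ central ? 0 : −F₀(i)·Y` is ℂ-linear in `Y` (finite combinations). [folklore] -/
theorem responseDir_sum_smul {ι : Type*} (cen : ι → Prop) [DecidablePred cen] (F₀ : ι → MatA 2) (z : Fin 3 → ℂ) (Y : Fin 3 → MatA 2) :
    (fun i => if cen i then (0 : MatA 2) else -(F₀ i * ∑ b, z b • Y b)) = ∑ b, z b • fun i => if cen i then (0 : MatA 2) else -(F₀ i * Y b) := by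
  funext i
  rw [Finset.sum_apply]
  by_cases hc : cen i
  · simp only [hc, if_true, Pi.smul_apply, smul_zero, Finset.sum_const_zero]
  · simp only [hc, if_false, Pi.smul_apply, Matrix.mul_sum, mul_smul_comm, smul_neg, Finset.sum_neg_distrib]

/-- ★★★ **`det A₁^ℂ(c)(W)` IS WITHIN `r³∕2` OF ITS FLAT VALUE `r³`, `r = N_c∕|I|`**, for every `SL(2,ℂ)`-valued bond-matrix field `W` whose (0.4) loop matrices lie in the `1∕3`-polydisc at every coarse
bond and within `α` of `1` at the non-central indices of `c`, provided `646·α ≤ r∕8` (`α ≤ 1∕24`).  ROAD: `A₁^ℂ(c)(W) = N·Ad^ℂ(pre)` with `det Ad^ℂ(pre) = 1` (✓p812578 `det_adMatC`) and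
`N_{ib} = su2CoordC((D eml[i ↦ cen ? 0 : −loop_i·su2Gen b] + eml·su2Gen b)·adj eml)_i` within `646α` of `r·δ_{ib}` (§4 + `‖adj eml − 1‖ ≤ 18α`), then the `3 × 3` perturbation bound.
[cite: Balaban1987RG1, p.267 («h(c)»), (0.8) p.253, (1.18) p.263; Balaban1985Variational, Prop. 9 p.309] -/
theorem norm_det_jacBlockC_sub_le (hj : j + 1 ≤ P.m + P.K) (W : PBond P j → MatA 2) (hW : ∀ b, (W b).det = 1)
    (hpoly : ∀ (c : PBond P (j + 1)) (i : Idx P), ‖loopMh W c i - 1‖ < 1 / 3) (c : PBond P (j + 1))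
    {α : ℝ} (hα0 : 0 ≤ α) (hα : α ≤ 1 / 24) (hloop : ∀ i, ¬ IsCentral c i → ‖loopMh W c i - 1‖ ≤ α)
    (hαr : 646 * α ≤ (nCentral c : ℝ) / (Fintype.card (Idx P) : ℝ) / 8) :
    ‖(jacBlockC c W).det - (((nCentral c : ℝ) / (Fintype.card (Idx P) : ℝ) : ℝ) : ℂ) ^ 3‖ ≤
      ((nCentral c : ℝ) / (Fintype.card (Idx P) : ℝ)) ^ 3 / 2 := by
  classical
  haveI := nonempty_idxP (P := P)
  set r : ℝ := (nCentral c : ℝ) / (Fintype.card (Idx P) : ℝ) with hr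
  have hcardpos : (0 : ℝ) < Fintype.card (Idx P) := by exact_mod_cast Fintype.card_pos
  have hr0 : 0 < r := div_pos (by exact_mod_cast BlockAveragingHaarAC.nCentral_pos c) hcardpos
  have hr1 : r ≤ 1 := by
    rw [hr, div_le_one hcardpos]
    exact_mod_cast (Finset.card_filter_le _ _).trans (Finset.card_univ (α := Idx P)).le
  have hrC : ((r : ℝ) : ℂ) = (nCentral c : ℂ) / (Fintype.card (Idx P) : ℂ) := by rw [hr]; push_cast; rfl
  set β := centralBond c with hβ
  set pre := holMh W (walk (emb c.src) (List.replicate ((P.L - 1) / 2) (c.dir, true))) with hpre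
  set F₀ : Idx P → MatA 2 := fun i => loopMh W c i with hF₀
  set E := eml F₀ with hE
  set A := axialMh W c with hA
  set D := fderiv ℂ (eml : (Idx P → MatA 2) → MatA 2) F₀ with hD
  set H : MatA 2 → Idx P → MatA 2 := fun Y i => if IsCentral c i then 0 else -(F₀ i * Y) with hH
  set T : Fin 3 → MatA 2 := fun b => D (H (su2Gen b)) + E * su2Gen b with hT
  have hpoly1 : ∀ (c' : PBond P (j + 1)) (i : Idx P), ‖loopMh W c' i - 1‖ < 1 := fun c' i => (hpoly c' i).trans (by norm_num)
  have hdpre : pre.det = 1 := det_holMh_eq_one W hW _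
  have hdA : A.det = 1 := det_holMh_eq_one W hW _
  -- the loop family: central ones are `1`, all are within `α` and within `1∕3`
  have hFα : ∀ i, ‖F₀ i - 1‖ ≤ α := fun i => by
    by_cases hc : IsCentral c i
    · simp only [hF₀, loopMh_of_isCentral W hW c i hc, sub_self, norm_zero]; exact hα0
    · exact hloop i hc
  have hdE : E.det = 1 := by
    refine ExpMeanLog.det_eml_eq_one (fun i => det_holMh_eq_one W hW _) (fun i => (hpoly c i).le) fun i => ?_
    have h3 := hpoly c i
    rw [Fintype.card_fin]
    have hπ : (3 : ℝ) < Real.pi := Real.pi_gt_three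
    push_cast
    linarith
  have hE1 : ‖E - 1‖ ≤ 6 * α := norm_eml_sub_one_le_six_mul hFα (hα.trans (by norm_num))
  have hadjE1 : ‖E.adjugate - 1‖ ≤ 18 * α := (norm_adjugate_sub_one_le E).trans (by linarith)
  have hadjE : ‖E.adjugate‖ ≤ 2 := by
    have h := norm_add_le (E.adjugate - 1) (1 : MatA 2)
    rw [sub_add_cancel, norm_one] at h
    linarith [hα]
  -- (1) the inverse of the average through adjugates
  have havg : avgMh W c = E * A := rfl
  have hinv : (avgMh W c)⁻¹ = A.adjugate * E.adjugate := by
    refine Matrix.inv_eq_left_inv ?_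
    rw [havg, ← Matrix.adjugate_mul_distrib, Matrix.adjugate_mul, Matrix.det_mul, hdE, hdA, mul_one, one_smul]
  -- (2) the entries `T_b` are within `314α` of `r·su2Gen b`, hence `N_{ib}` within `646α` of `r δ`
  have hTb : ∀ b, ‖T b - (r : ℂ) • su2Gen b‖ ≤ 314 * α := fun b => by
    have h := norm_centralResponseC_sub_le (IsCentral c) F₀ (fun i hc => loopMh_of_isCentral W hW c i hc) hα0 hα hloop (su2Gen b)
    rw [norm_su2Gen, mul_one] at h
    have e : D (H (su2Gen b)) + E * su2Gen b - su2Gen b + (((Finset.univ.filter fun i : Idx P => ¬ IsCentral c i).card : ℂ) / (Fintype.card (Idx P) : ℂ)) • su2Gen b =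
        T b - (r : ℂ) • su2Gen b := by
      rw [hrC, ← one_sub_nonCentral_div_eq c, sub_smul, one_smul]; simp only [hT]; abel
    rw [← e]; exact h
  have hN : ∀ i b, ‖su2CoordC (T b * E.adjugate) i - (if i = b then (r : ℂ) else 0)‖ ≤ 646 * α := fun i b => by
    have hδ : (if i = b then ((r : ℝ) : ℂ) else 0) = su2CoordC ((r : ℂ) • su2Gen b) i := by
      rw [su2CoordC_smul, su2CoordC_su2Gen, mul_ite, mul_one, mul_zero]
    rw [hδ, ← su2CoordC_sub]
    refine (norm_su2CoordC_le _ i).trans ?_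
    have e : T b * E.adjugate - (r : ℂ) • su2Gen b = (T b - (r : ℂ) • su2Gen b) * E.adjugate + (r : ℂ) • (su2Gen b * (E.adjugate - 1)) := by
      rw [sub_mul, Matrix.smul_mul, mul_sub, mul_one, smul_sub]; abel
    rw [e]
    calc _ ≤ ‖(T b - (r : ℂ) • su2Gen b) * E.adjugate‖ + ‖(r : ℂ) • (su2Gen b * (E.adjugate - 1))‖ := norm_add_le _ _
      _ ≤ 314 * α * 2 + r * (1 * (18 * α)) := by
          refine add_le_add ((norm_mul_le _ _).trans (mul_le_mul (hTb b) hadjE (norm_nonneg _) (by positivity))) ?_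
          rw [norm_smul, Complex.norm_real, Real.norm_of_nonneg hr0.le]
          exact mul_le_mul_of_nonneg_left ((norm_mul_le _ _).trans (by rw [norm_su2Gen]; exact mul_le_mul_of_nonneg_left hadjE1 zero_le_one)) hr0.le
      _ ≤ 646 * α := by nlinarith
  -- (3) the block is `N · Ad^ℂ(pre)`
  set N : Matrix (Fin 3) (Fin 3) ℂ := Matrix.of fun i b => su2CoordC (T b * E.adjugate) i with hNdef
  set Ad : Matrix (Fin 3) (Fin 3) ℂ := Matrix.of fun b a => su2CoordC (pre * su2Gen a * pre.adjugate) b with hAd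
  have hlin : ∀ z : Fin 3 → ℂ, D (H (∑ b, z b • su2Gen b)) + E * ∑ b, z b • su2Gen b = ∑ b, z b • T b := by
    intro z
    simp only [hT, smul_add, Finset.sum_add_distrib, Matrix.mul_sum, mul_smul_comm]
    congr 1
    rw [show H (∑ b, z b • su2Gen b) = ∑ b, z b • H (su2Gen b) from responseDir_sum_smul (IsCentral c) F₀ z fun b => su2Gen b,
      map_sum]
    exact Finset.sum_congr rfl fun b _ => by rw [map_smul]
  have hblock : jacBlockC c W = N * Ad := by
    ext i a
    have htr : (pre * su2Gen a * pre.adjugate).trace = 0 := by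
      rw [Matrix.trace_mul_cycle, adjugate_mul_self_of_det_eq_one hdpre, one_mul]; exact trace_su2Gen a
    have hXt : pre * su2Gen a * pre.adjugate = ∑ b, Ad b a • su2Gen b := by
      rw [← sum_su2CoordC_smul_su2Gen htr]; rfl
    have hresp := fderiv_avgMh_single_centralBond_eq hj W hW hpoly1 c (trace_su2Gen a)
    rw [jacBlockC, Matrix.of_apply, Matrix.mul_apply, hresp, hinv]
    have e : (D (fun i => if IsCentral c i then 0 else -(loopMh W c i * (pre * su2Gen a * pre.adjugate))) * A +
          E * (pre * su2Gen a * pre.adjugate * A)) * (A.adjugate * E.adjugate) =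
        (∑ b, Ad b a • T b) * E.adjugate := by
      rw [← hlin, ← hXt]
      calc _ = (D (H (pre * su2Gen a * pre.adjugate)) + E * (pre * su2Gen a * pre.adjugate)) * (A * A.adjugate) * E.adjugate := by
              simp only [hH, hF₀]; noncomm_ring
        _ = _ := by rw [self_mul_adjugate_of_det_eq_one hdA, mul_one]
    rw [e, Finset.sum_mul, show (∑ b, Ad b a • T b * E.adjugate) = ∑ b, Ad b a • (T b * E.adjugate) from
      Finset.sum_congr rfl fun b _ => Matrix.smul_mul _ _ _, su2CoordC_sum_smul]
    refine Finset.sum_congr rfl fun b _ => ?_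
    simp only [hNdef, Matrix.of_apply]
    ring
  have hdetAd : Ad.det = 1 := det_adMatC_of_det_eq_one hdpre
  have hdet : (jacBlockC c W).det = N.det := by rw [hblock, Matrix.det_mul, hdetAd, mul_one]
  -- (4) the `3 × 3` perturbation bound
  rw [hdet]
  have he0 : (0 : ℝ) ≤ 646 * α := by positivity
  have hper := norm_det_sub_cube_le N hr0.le he0 (fun i b => by simp only [hNdef, Matrix.of_apply]; exact hN i b)
  refine hper.trans ?_
  have he : 646 * α ≤ r / 8 := hαr
  nlinarith [mul_le_mul_of_nonneg_left he (by positivity : (0:ℝ) ≤ r ^ 2),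
    mul_le_mul he he he0 (by positivity), pow_le_pow_left₀ he0 he 3, hr0.le, sq_nonneg r]


/-- **… hence `det A₁^ℂ(c)(W)` lies in the slit plane** (its real part is at least `r³∕2 > 0`). [cite: Balaban1987RG1, (1.18) p.263, p.268] -/
theorem det_jacBlockC_mem_slitPlane (hj : j + 1 ≤ P.m + P.K) (W : PBond P j → MatA 2) (hW : ∀ b, (W b).det = 1)
    (hpoly : ∀ (c : PBond P (j + 1)) (i : Idx P), ‖loopMh W c i - 1‖ < 1 / 3) (c : PBond P (j + 1))
    {α : ℝ} (hα0 : 0 ≤ α) (hα : α ≤ 1 / 24) (hloop : ∀ i, ¬ IsCentral c i → ‖loopMh W c i - 1‖ ≤ α)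
    (hαr : 646 * α ≤ (nCentral c : ℝ) / (Fintype.card (Idx P) : ℝ) / 8) :
    (jacBlockC c W).det ∈ Complex.slitPlane := by
  haveI := nonempty_idxP (P := P)
  set r : ℝ := (nCentral c : ℝ) / (Fintype.card (Idx P) : ℝ) with hr
  have hr0 : 0 < r := div_pos (by exact_mod_cast BlockAveragingHaarAC.nCentral_pos c) (by exact_mod_cast Fintype.card_pos)
  have h := norm_det_jacBlockC_sub_le hj W hW hpoly c hα0 hα hloop hαr
  rw [Complex.mem_slitPlane_iff]
  left
  have hre : ((r : ℂ) ^ 3 - (jacBlockC c W).det).re ≤ ‖(jacBlockC c W).det - (r : ℂ) ^ 3‖ := by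
    rw [← norm_neg, neg_sub]; exact Complex.re_le_norm _
  have h3 : ((r : ℂ) ^ 3).re = r ^ 3 := by rw [← Complex.ofReal_pow, Complex.ofReal_re]
  rw [Complex.sub_re, h3] at hre
  have hr3 : 0 < r ^ 3 := pow_pos hr0 3
  linarith

/-- The holomorphic average of an `SL(2,ℂ)`-valued field in the `1∕3`-polydisc is invertible (`det = 1`, ✓p812756). [cite: Balaban1987RG1, (0.4) p.253 (bookkeeping)] -/
theorem isUnit_avgMh_of_det_eq_one (W : PBond P j → MatA 2) (hW : ∀ b, (W b).det = 1) (c : PBond P (j + 1))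
    (hpoly : ∀ i : Idx P, ‖loopMh W c i - 1‖ < 1 / 3) : IsUnit (avgMh W c) := by
  rw [Matrix.isUnit_iff_isUnit_det, det_avgMh_eq_one W hW c hpoly]
  exact isUnit_one

/-- ★★★ **ROW (a) OF `stub_LZjac` ON THE LOOP-SMALL `SL(2,ℂ)` DOMAIN**: the holomorphic Jacobian factor `jacFactorC c = log det A₁^ℂ(c)(·)` is ℂ-ANALYTIC at every `SL(2,ℂ)`-valued field whose
(0.4) loop matrices lie in the `1∕3`-polydisc at every coarse bond and within `α` of `1` at the non-central indices of `c`, `646·α ≤ (N_c∕|I|)∕8` — ✓p812449 `analyticAt_jacFactorC` with its three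
hypotheses (polydisc, invertible average, `det` off the slit) DISCHARGED. [cite: Balaban1987RG1, (1.18) p.263 («analytic functions on the spaces (1.11)–(1.16)»), p.267–268; Balaban1985Variational, Prop. 9 p.309] -/
theorem analyticAt_jacFactorC_of_loopSmall (hj : j + 1 ≤ P.m + P.K) (W : PBond P j → MatA 2) (hW : ∀ b, (W b).det = 1)
    (hpoly : ∀ (c : PBond P (j + 1)) (i : Idx P), ‖loopMh W c i - 1‖ < 1 / 3) (c : PBond P (j + 1))
    {α : ℝ} (hα0 : 0 ≤ α) (hα : α ≤ 1 / 24) (hloop : ∀ i, ¬ IsCentral c i → ‖loopMh W c i - 1‖ ≤ α)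
    (hαr : 646 * α ≤ (nCentral c : ℝ) / (Fintype.card (Idx P) : ℝ) / 8) :
    AnalyticAt ℂ (jacFactorC c : (PBond P j → MatA 2) → ℂ) W :=
  analyticAt_jacFactorC (fun c' i => (hpoly c' i).trans (by norm_num)) c (isUnit_avgMh_of_det_eq_one W hW c (hpoly c))
    (det_jacBlockC_mem_slitPlane hj W hW hpoly c hα0 hα hloop hαr)

/-- ★★ **ROW (b): THE JACOBIAN FACTOR IS WITHIN `1` OF `log r³`** on the same domain: `‖jacFactorC c W − log((N_c∕|I|)³)‖ ≤ 1` (`det = r³(1 + w)`, `|w| ≤ ½`, `|log(1 + w)| ≤ (3∕2)|w|`).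
[cite: Balaban1987RG1, (1.18) p.263, p.268] -/
theorem norm_jacFactorC_sub_log_le (hj : j + 1 ≤ P.m + P.K) (W : PBond P j → MatA 2) (hW : ∀ b, (W b).det = 1)
    (hpoly : ∀ (c : PBond P (j + 1)) (i : Idx P), ‖loopMh W c i - 1‖ < 1 / 3) (c : PBond P (j + 1))
    {α : ℝ} (hα0 : 0 ≤ α) (hα : α ≤ 1 / 24) (hloop : ∀ i, ¬ IsCentral c i → ‖loopMh W c i - 1‖ ≤ α)
    (hαr : 646 * α ≤ (nCentral c : ℝ) / (Fintype.card (Idx P) : ℝ) / 8) :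
    ‖jacFactorC c W - ((Real.log (((nCentral c : ℝ) / (Fintype.card (Idx P) : ℝ)) ^ 3) : ℝ) : ℂ)‖ ≤ 1 := by
  haveI := nonempty_idxP (P := P)
  set r : ℝ := (nCentral c : ℝ) / (Fintype.card (Idx P) : ℝ) with hr
  have hr0 : 0 < r := div_pos (by exact_mod_cast BlockAveragingHaarAC.nCentral_pos c) (by exact_mod_cast Fintype.card_pos)
  have hr3 : 0 < r ^ 3 := pow_pos hr0 3
  have h := norm_det_jacBlockC_sub_le hj W hW hpoly c hα0 hα hloop hαr
  set z := (jacBlockC c W).det with hz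
  -- `z = r³ (1 + w)` with `‖w‖ ≤ 1∕2`
  set w : ℂ := z / (r : ℂ) ^ 3 - 1 with hw
  have hr3C : ((r : ℂ) ^ 3) ≠ 0 := by exact_mod_cast hr3.ne'
  have hzw : z = ((r ^ 3 : ℝ) : ℂ) * (1 + w) := by
    rw [hw, Complex.ofReal_pow, add_sub_cancel, mul_div_cancel₀ _ hr3C]
  have hwn : ‖w‖ ≤ 1 / 2 := by
    have e : w = (z - (r : ℂ) ^ 3) / (r : ℂ) ^ 3 := by rw [hw, sub_div, div_self hr3C]
    rw [e, norm_div, norm_pow, Complex.norm_real, Real.norm_of_nonneg hr0.le, div_le_iff₀ hr3]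
    linarith
  have hw1 : 1 + w ≠ 0 := by
    intro h0
    have : ‖w‖ = 1 := by rw [show w = -1 from eq_neg_of_add_eq_zero_right h0, norm_neg, norm_one]
    linarith
  show ‖Complex.log z - ((Real.log (r ^ 3) : ℝ) : ℂ)‖ ≤ 1
  rw [hzw, Complex.log_ofReal_mul hr3 hw1, add_sub_cancel_left]
  exact (Complex.norm_log_one_add_half_le_self hwn).trans (by linarith)

end Summit.QuantumFields.YangMills.Theorems.BalabanUVNodesPortS1

end
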